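import Summits.BirchSwinnertonDyer.BirchSwinnertonDyer.Theses.RamifiedHeegnerPair
import Summits.BirchSwinnertonDyer.BirchSwinnertonDyer.Theorems.TameQuarticSolventSolventPairLowerBoundPairGivenGoodFieldOf
import Summits.BirchSwinnertonDyer.Rank1Residual.AdditivePotMult.ModelFree
import Literature.NumberTheory.EllipticCurves.Milne1972.WeilRestrictionQuadraticBSDQuotientAnyModel
import Literature.NumberTheory.EllipticCurves.BSDQuotientOverNumberField
import HarnessLib

/-!
# Route `RamifiedHeegnerPair`, crux X1 `RamifiedPairLowerBound` (stmt-BirchSwinnertonDyer-23191), line `birth` —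
# the crux BY NAME from the displayed published inputs and ONE statement over the 3-ramified field:
# the lower half of `BSD₃` for `E` over `K = ℚ(√d)`

HONEST FRAMING. Theorems only; helper file (`--supports stmt-BirchSwinnertonDyer-23191`). The crux
`RamifiedPairLowerBound` (the LOWER half of `BSD₃` for the 3-ramified twist pair `(E, E^{(d)})` on the
W-ALL leaf Gss2 at `3`) is NOT proved here and BSD is not proved by any of this. What this file proves is
the kernel-checked REDUCTION asked of the line `birth` (its stubs L1 field / L2 finiteness / L4 ascent of
`Ш` / L3 signed lower bound over `K`): GIVEN the route's displayed published inputs — Gross–Zagier–Kolyvagin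
(`rank_eq_analyticRank_of_analyticRank_le_one`, the route's `PublishedInputGZK`), modularity
(`hasEntireLFunction_rat`, `nonempty_modularParametrizationData`), Gross–Zagier 1986 Thm. I.(7.3)
(`GrossZagier1986_thm_I_7_3`) and Milne 1972 Thm. 1 in Dokchitser–Dokchitser's model-free form
(`Milne1972.bsdQuotient_baseChange_quadratic_anyModel`) — the crux follows from ONE statement over the
imaginary quadratic field `K = ℚ(√d)` in which `3` ramifies:

  `LowerHalfOverK`: for `(W, V, d)` as in the crux and `K = ℚ(θ)`, `θ² = d`, `[K : ℚ] = 2`, with `Ш(W_K)`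
  finite: `#Ш_an(W_K/K)` (the tree's `analyticSha (W.baseChange K)`, Dokchitser–Dokchitser / Miller
  currency on the model `W_K`) is a rational `q` with `ord₃ q ≤ ord₃ #Ш(W_K/K)`

— the `ℚ`-to-`K` shadow named in the route thesis (Heegner-point / signed anticyclotomic main conjecture
`⊇` for `A = E/K`, good supersingular at the RAMIFIED prime above `3`, `r_an(A/K) = 1`). It is displayed
as the explicit hypothesis `hKR` of `ramifiedPairLowerBound_of_lowerHalfOverK`, written as a closed term
in existing tree vocabulary so that the planner can file it verbatim; nothing about it is asserted.

THE BOOKKEEPING (all tree theorems): `K = ℚ(√d)` exists (`SolventPairLowerBound.exists_quadraticField_sq_eq_intCast`,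
`d` is no square since `ord₃ d = 1`); a model of `W^{(d)}` is a model of `W^{(d_K)}`
(`SolventPairLowerBound.exists_variableChange_quadraticTwist_discr`); `Ш(W)`, `Ш(V)` are finite (GZK,
`r_an ≤ 1` each); Milne's identity gives `Ш(W_K)` finite and the Weil-restriction equation `hWR`; Artin
formalism and `hWR` give `(★)` `#Ш_an(W_K)·#Ш(W)·#Ш(V) = #Ш_an(W)·#Ш_an(V)·#Ш(W_K)`
(`AdditivePotMult.shaAnOverC_mul_eq`; `analyticSha` is `shaAnOverC` by `rfl`); `#Ш_an(W)`, `#Ш_an(V)`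
are non-zero rationals (`exists_rat_shaAn_eq_of_analyticRank_le_one`: modular symbols in rank `0`,
Gross–Zagier I.(7.3) in rank `1`; `AdditivePotMult.shaAn_ne_zero`); taking `ord₃` of `(★)` and the
over-`K` inequality gives `ord₃ #Ш_an(W) + ord₃ #Ш_an(V) ≤ ord₃ #Ш(W) + ord₃ #Ш(V)`.

References: J. S. Milne, Invent. Math. 17 (1972) Thm. 1; T. Dokchitser, V. Dokchitser, Ann. of Math.
172 (2010) §2.1; B. Gross, D. Zagier, Invent. Math. 84 (1986) Thm. I.(7.3); V. A. Kolyvagin, *Euler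
systems* (1990); R. L. Miller, LMS J. Comput. Math. 14 (2011) §1; K. Ireland, M. Rosen, Prop. 20.5.4.
-/

-- D-0017: single-problem summit, so `Summit.BirchSwinnertonDyer.BirchSwinnertonDyer.…` repeats a namespace BY DESIGN.
set_option linter.dupNamespace false

noncomputable section

open scoped Classical

open WeierstrassCurve Literature.NumberTheory.EllipticCurves
  Literature.NumberTheory.EllipticCurves.ModularForms Literature.NumberTheory.EllipticCurves.Rank1Residual

namespace Summit.BirchSwinnertonDyer.BirchSwinnertonDyer.Theorems.RamifiedPairLowerBound

/-! ## Two inputs over `ℚ` -/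

/-- **`#Ш_an(E) ∈ ℚ` in analytic rank `≤ 1`** for a globally minimal `W/ℚ`: rank `0` by modular symbols
(`SolventPairLowerBound.exists_rat_shaAn_eq_of_analyticRank_eq_zero`: `L(E,1) = [0]⁺Ω⁺_f`, `Ω⁺_f = ϖΩ_E`),
rank `1` by Gross–Zagier Thm. I.(7.3) with Gross–Zagier–Kolyvagin
(`Disegni2020.exists_rat_shaAn_eq_of_analyticRank_eq_one`). [cite: GrossZagier1986, Thm. I.(7.3) 2) (p. 231)]
[cite: MazurTateTeitelbaum1986Invent, §I.8 (8.6)] [cite: Miller2011LMS, §1 (arXiv:1010.2431 p. 3)] -/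
theorem exists_rat_shaAn_eq_of_analyticRank_le_one (hmodP : nonempty_modularParametrizationData)
    (hGZ : GrossZagier1986_thm_I_7_3) (hGZK : rank_eq_analyticRank_of_analyticRank_le_one)
    (W : WeierstrassCurve ℚ) [W.IsElliptic] [W.IsGloballyMinimal] (hr : W.analyticRank ≤ 1) :
    ∃ q : ℚ, shaAn W = (q : ℂ) := by
  rcases Nat.le_one_iff_eq_zero_or_eq_one.mp hr with h0 | h1
  · exact SolventPairLowerBound.exists_rat_shaAn_eq_of_analyticRank_eq_zero hmodP hGZK W h0
  · exact Disegni2020.exists_rat_shaAn_eq_of_analyticRank_eq_one hGZ hGZK W h1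

/-- **Valuation bookkeeping of the pair.** If non-zero rationals satisfy `qK · sW · sV = q · q' · sK` with
`sW, sV, sK` positive naturals (the identity `(★)` read in `ℚ`) and `ord_p qK ≤ ord_p sK` (the lower half
over `K`), then `ord_p q + ord_p q' ≤ ord_p sW + ord_p sV`. [folklore] -/
theorem padicValRat_add_le_of_mul_eq (p : ℕ) [Fact p.Prime] {qK q q' : ℚ} {sW sV sK : ℕ}
    (hq : q ≠ 0) (hq' : q' ≠ 0) (hsW : sW ≠ 0) (hsV : sV ≠ 0) (hsK : sK ≠ 0)
    (hQ : qK * sW * sV = q * q' * sK) (hle : padicValRat p qK ≤ (padicValNat p sK : ℤ)) :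
    padicValRat p q + padicValRat p q' ≤ (padicValNat p sW : ℤ) + (padicValNat p sV : ℤ) := by
  have hsWq : (sW : ℚ) ≠ 0 := by exact_mod_cast hsW
  have hsVq : (sV : ℚ) ≠ 0 := by exact_mod_cast hsV
  have hsKq : (sK : ℚ) ≠ 0 := by exact_mod_cast hsK
  have hqK : qK ≠ 0 := by
    intro h0
    rw [h0, zero_mul, zero_mul] at hQ
    exact mul_ne_zero (mul_ne_zero hq hq') hsKq hQ.symm
  have hv := congrArg (padicValRat p) hQ
  rw [padicValRat.mul (mul_ne_zero hqK hsWq) hsVq, padicValRat.mul hqK hsWq,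
    padicValRat.mul (mul_ne_zero hq hq') hsKq, padicValRat.mul hq hq',
    padicValRat.of_nat, padicValRat.of_nat, padicValRat.of_nat] at hv
  linarith

/-! ## The crux from the published inputs and the lower half over `K` -/

/-- **`RamifiedPairLowerBound` from the displayed published inputs and the lower half of `BSD₃` over the
3-ramified field.** GIVEN Gross–Zagier–Kolyvagin (`hGZK`, the route's `PublishedInputGZK`), modularity
(`hE` entire continuation of `L(E,s)`, `hmodP` modular parametrisations), Gross–Zagier 1986 Thm. I.(7.3)
(`hGZ`), Milne 1972 Thm. 1 / Dokchitser–Dokchitser 2010 §2.1 on an arbitrary `K`-model (`hMilne`), and the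
ONE over-`K` statement `hKR` («LowerHalfOverK»: for every `(W, V, d)` as in the crux and every quadratic
field `K = ℚ(θ)`, `θ² = d`, with `Ш(W_K)` finite, `#Ш_an(W_K/K) = analyticSha (W.baseChange K)` is a
rational `q` with `ord₃ q ≤ ord₃ #Ш(W_K/K)` — the Heegner-point / signed main-conjecture `⊇` shadow over the
3-RAMIFIED `K`, NOT in print, NOT proved here), the route crux `RamifiedPairLowerBound` holds. Proof: the
module docstring's bookkeeping — `K = ℚ(√d)`, `V ≅ W^{(d_K)}`, GZK finiteness over `ℚ`, Milne's identity,
`(★)` = `AdditivePotMult.shaAnOverC_mul_eq`, rationality of `#Ш_an` in analytic rank `≤ 1`, and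
`padicValRat_add_le_of_mul_eq`. [cite: Milne1972ArithmeticAV, §1 Thm. 1]
[cite: DokchitserDokchitserAnnals2010, §2.1: statement 2.1, Notation, proof of Thm. 2.3]
[cite: GrossZagier1986, Thm. I.(7.3)] [cite: Miller2011LMS, §1 and Def. 1.1 (arXiv:1010.2431 p. 3)] -/
theorem ramifiedPairLowerBound_of_lowerHalfOverK
    (hGZK : rank_eq_analyticRank_of_analyticRank_le_one) (hE : hasEntireLFunction_rat)
    (hmodP : nonempty_modularParametrizationData) (hGZ : GrossZagier1986_thm_I_7_3)
    (hMilne : Milne1972.bsdQuotient_baseChange_quadratic_anyModel)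
    (hKR : ∀ (W : WeierstrassCurve ℚ) [W.IsElliptic] [W.IsGloballyMinimal]
      (V : WeierstrassCurve ℚ) [V.IsElliptic] [V.IsGloballyMinimal] (d : ℤ),
      ¬ W.HasCM → Addv W 3 → Summit.BirchSwinnertonDyer.Rank1Residual.Additive.SubGss W 3 →
      d < 0 → padicValInt 3 d = 1 → Squarefree d →
      (∃ C : WeierstrassCurve.VariableChange ℚ, C • W.quadraticTwist (d : ℚ) = V) →
      GoodSS V 3 → W.analyticRank + V.analyticRank = 1 →
      ∀ (K : Type) [Field K] [NumberField K] (θ : K), Module.finrank ℚ K = 2 → θ ^ 2 = (d : K) →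
        (W.baseChange K).ShaFinite →
        ∃ q : ℚ, analyticSha (W.baseChange K) = (q : ℂ) ∧
          padicValRat 3 q ≤ (padicValNat 3 (W.baseChange K).shaOrder : ℤ)) :
    Summit.BirchSwinnertonDyer.BirchSwinnertonDyer.Theses.RamifiedHeegnerPair.RamifiedPairLowerBound := by
  intro W _ _ V _ _ d hCM hadd hsub hd hv hsq hC hss hsum
  -- analytic ranks `≤ 1` and finiteness of `Ш` over `ℚ` (Gross–Zagier–Kolyvagin)
  have hrW : W.analyticRank ≤ 1 := by omega
  have hrV : V.analyticRank ≤ 1 := by omega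
  have hWfin : W.ShaFinite := (hGZK W hrW).2
  have hVfin : V.ShaFinite := (hGZK V hrV).2
  -- the field `K = ℚ(√d)` (`d` is not a square: `ord₃ d = 1`)
  obtain ⟨K, _, _, θ, h2, hθ, hθK⟩ := SolventPairLowerBound.exists_quadraticField_sq_eq_intCast
    (SolventPairLowerBound.not_isSquare_ratCast_of_padicValInt_eq_one 3 hv)
  -- `V` is a model of the twist by the discriminant `d_K = d q²`
  have hVd : ∃ C : WeierstrassCurve.VariableChange ℚ,
      C • W.quadraticTwist (NumberField.discr K : ℚ) = V :=
    SolventPairLowerBound.exists_variableChange_quadraticTwist_discr h2 hθ hθK W V hC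
  -- the `K`-model `W_K`
  haveI : (W.baseChange K).IsElliptic := by
    rw [WeierstrassCurve.baseChange]; infer_instance
  have hV' : ∃ C : WeierstrassCurve.VariableChange K, C • W.baseChange K = W.baseChange K :=
    ⟨1, one_smul _ _⟩
  -- Milne: `Ш(W_K)` finite and the Weil-restriction identity on the model `W_K`
  obtain ⟨hKfin, hWR⟩ := hMilne W K h2 V hVd (W.baseChange K) hV' hWfin hVfin
  -- (★): `#Ш_an(W_K)·#Ш(W)·#Ш(V) = #Ш_an(W)·#Ш_an(V)·#Ш(W_K)` in `ℂ`
  have hstar := Summit.BirchSwinnertonDyer.Rank1Residual.AdditivePotMult.shaAnOverC_mul_eq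
    W K V (W.baseChange K) hE h2 hVd hV' hWfin hVfin hWR
  -- rationality over `ℚ`
  obtain ⟨q, hq⟩ := exists_rat_shaAn_eq_of_analyticRank_le_one hmodP hGZ hGZK W hrW
  obtain ⟨q', hq'⟩ := exists_rat_shaAn_eq_of_analyticRank_le_one hmodP hGZ hGZK V hrV
  -- the lower half over `K`
  obtain ⟨qK, hqK, hle⟩ := hKR W V d hCM hadd hsub hd hv hsq hC hss hsum K θ h2 hθ hKfin
  have hqK' : Summit.BirchSwinnertonDyer.Rank1Residual.AdditivePotMult.shaAnOverC (W.baseChange K) =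
      (qK : ℂ) := hqK
  refine ⟨q, q', hq, hq', ?_⟩
  -- non-vanishing
  have hsW : W.shaOrder ≠ 0 := (W.shaOrder_pos hWfin).ne'
  have hsV : V.shaOrder ≠ 0 := (V.shaOrder_pos hVfin).ne'
  have hsK : (W.baseChange K).shaOrder ≠ 0 := ((W.baseChange K).shaOrder_pos hKfin).ne'
  have hq0 : q ≠ 0 := by
    intro h0
    apply Summit.BirchSwinnertonDyer.Rank1Residual.AdditivePotMult.shaAn_ne_zero W hE
    rw [hq, h0, Rat.cast_zero]
  have hq0' : q' ≠ 0 := by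
    intro h0
    apply Summit.BirchSwinnertonDyer.Rank1Residual.AdditivePotMult.shaAn_ne_zero V hE
    rw [hq', h0, Rat.cast_zero]
  -- (★) in `ℚ`
  have hQ : qK * W.shaOrder * V.shaOrder = q * q' * (W.baseChange K).shaOrder := by
    have h : ((qK * W.shaOrder * V.shaOrder : ℚ) : ℂ) =
        ((q * q' * (W.baseChange K).shaOrder : ℚ) : ℂ) := by
      push_cast
      rw [← hq, ← hq', ← hqK']
      exact hstar
    exact_mod_cast h
  exact padicValRat_add_le_of_mul_eq 3 hq0 hq0' hsW hsV hsK hQ hle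

/-! ## The reshape is LOSSLESS: the crux gives back the lower half over `K` (appended 2026-08-28, lead rhp-p1 g0) -/

/-- **Valuation bookkeeping of the pair, converse direction.** If non-zero rationals satisfy
`qK · sW · sV = q · q' · sK` with `sW, sV, sK` positive naturals and `ord_p q + ord_p q' ≤ ord_p sW + ord_p sV`
(the pair inequality over `ℚ`), then `ord_p qK ≤ ord_p sK` (the lower half over `K`). [folklore] -/
theorem padicValRat_le_of_mul_eq (p : ℕ) [Fact p.Prime] {qK q q' : ℚ} {sW sV sK : ℕ}
    (hq : q ≠ 0) (hq' : q' ≠ 0) (hsW : sW ≠ 0) (hsV : sV ≠ 0) (hsK : sK ≠ 0)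
    (hQ : qK * sW * sV = q * q' * sK)
    (hle : padicValRat p q + padicValRat p q' ≤ (padicValNat p sW : ℤ) + (padicValNat p sV : ℤ)) :
    padicValRat p qK ≤ (padicValNat p sK : ℤ) := by
  have hsWq : (sW : ℚ) ≠ 0 := by exact_mod_cast hsW
  have hsVq : (sV : ℚ) ≠ 0 := by exact_mod_cast hsV
  have hsKq : (sK : ℚ) ≠ 0 := by exact_mod_cast hsK
  have hqK : qK ≠ 0 := by
    intro h0
    rw [h0, zero_mul, zero_mul] at hQ
    exact mul_ne_zero (mul_ne_zero hq hq') hsKq hQ.symm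
  have hv := congrArg (padicValRat p) hQ
  rw [padicValRat.mul (mul_ne_zero hqK hsWq) hsVq, padicValRat.mul hqK hsWq,
    padicValRat.mul (mul_ne_zero hq hq') hsKq, padicValRat.mul hq hq',
    padicValRat.of_nat, padicValRat.of_nat, padicValRat.of_nat] at hv
  linarith

/-- **The lower half over `K` from `RamifiedPairLowerBound` (the reduction is lossless).** GIVEN three of the
displayed published inputs (`hGZK`, `hE`, `hMilne`; rationality over `ℚ` now comes from the crux itself), the route
crux `RamifiedPairLowerBound`
IMPLIES the over-`K` statement «LowerHalfOverK» of `ramifiedPairLowerBound_of_lowerHalfOverK` — so, modulo the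
published inputs, the registered load-bearing stub `stub_lowerHalfOverK` of the line `birth` is EQUIVALENT to the
crux, not a strengthening of it: for `(W, V, d)` as in the crux and any quadratic `K = ℚ(θ)`, `θ² = d`, with
`Ш(W_K)` finite, `analyticSha (W.baseChange K)` is a rational `qK` with `ord₃ qK ≤ ord₃ #Ш(W_K)`. Proof: the same
bookkeeping read backwards — `θ ∉ ℚ` since `ord₃ d = 1`, `V ≅ W^{(d_K)}`, Milne's identity, `(★)`
(`AdditivePotMult.shaAnOverC_mul_eq`), `#Ш_an(W_K) = q q' #Ш(W_K)/(#Ш(W) #Ш(V))`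
(`AdditivePotMult.exists_shaAnOverC_eq_of_rat`; `analyticSha = shaAnOverC` by `rfl`), and
`padicValRat_le_of_mul_eq`. BSD is not proved by any of this. [cite: Milne1972ArithmeticAV, §1 Thm. 1]
[cite: DokchitserDokchitserAnnals2010, §2.1: statement 2.1, Notation, proof of Thm. 2.3]
[cite: Miller2011LMS, §1 and Def. 1.1 (arXiv:1010.2431 p. 3)] -/
theorem lowerHalfOverK_of_ramifiedPairLowerBound
    (hGZK : rank_eq_analyticRank_of_analyticRank_le_one) (hE : hasEntireLFunction_rat)
    (hMilne : Milne1972.bsdQuotient_baseChange_quadratic_anyModel)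
    (hX1 : Summit.BirchSwinnertonDyer.BirchSwinnertonDyer.Theses.RamifiedHeegnerPair.RamifiedPairLowerBound) :
    ∀ (W : WeierstrassCurve ℚ) [W.IsElliptic] [W.IsGloballyMinimal]
      (V : WeierstrassCurve ℚ) [V.IsElliptic] [V.IsGloballyMinimal] (d : ℤ),
      ¬ W.HasCM → Addv W 3 → Summit.BirchSwinnertonDyer.Rank1Residual.Additive.SubGss W 3 →
      d < 0 → padicValInt 3 d = 1 → Squarefree d →
      (∃ C : WeierstrassCurve.VariableChange ℚ, C • W.quadraticTwist (d : ℚ) = V) →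
      GoodSS V 3 → W.analyticRank + V.analyticRank = 1 →
      ∀ (K : Type) [Field K] [NumberField K] (θ : K), Module.finrank ℚ K = 2 → θ ^ 2 = (d : K) →
        (W.baseChange K).ShaFinite →
        ∃ q : ℚ, analyticSha (W.baseChange K) = (q : ℂ) ∧
          padicValRat 3 q ≤ (padicValNat 3 (W.baseChange K).shaOrder : ℤ) := by
  intro W _ _ V _ _ d hCM hadd hsub hd hv hsq hC hss hsum K _ _ θ h2 hθ hKfin
  -- analytic ranks `≤ 1` and finiteness of `Ш` over `ℚ` (Gross–Zagier–Kolyvagin)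
  have hrW : W.analyticRank ≤ 1 := by omega
  have hrV : V.analyticRank ≤ 1 := by omega
  have hWfin : W.ShaFinite := (hGZK W hrW).2
  have hVfin : V.ShaFinite := (hGZK V hrV).2
  -- `θ ∉ ℚ`: `d` is not a rational square (`ord₃ d = 1`)
  have hθK : θ ∉ Set.range (algebraMap ℚ K) := by
    rintro ⟨r, hr⟩
    apply SolventPairLowerBound.not_isSquare_ratCast_of_padicValInt_eq_one 3 hv
    refine ⟨r, ?_⟩
    apply (algebraMap ℚ K).injective
    rw [map_mul, hr, ← sq, hθ, map_intCast]
  -- `V` is a model of the twist by the discriminant `d_K = d q²`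
  have hVd : ∃ C : WeierstrassCurve.VariableChange ℚ,
      C • W.quadraticTwist (NumberField.discr K : ℚ) = V :=
    SolventPairLowerBound.exists_variableChange_quadraticTwist_discr h2 hθ hθK W V hC
  -- the `K`-model `W_K`
  haveI : (W.baseChange K).IsElliptic := by
    rw [WeierstrassCurve.baseChange]; infer_instance
  have hV' : ∃ C : WeierstrassCurve.VariableChange K, C • W.baseChange K = W.baseChange K :=
    ⟨1, one_smul _ _⟩
  -- Milne: the Weil-restriction identity on the model `W_K`
  obtain ⟨-, hWR⟩ := hMilne W K h2 V hVd (W.baseChange K) hV' hWfin hVfin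
  -- rationality over `ℚ` and the crux's pair inequality
  obtain ⟨q, q', hq, hq', hle⟩ := hX1 W V d hCM hadd hsub hd hv hsq hC hss hsum
  -- `#Ш_an(W_K)` is rational: `q q' #Ш(W_K) / (#Ш(W) #Ш(V))`
  have hqK := Summit.BirchSwinnertonDyer.Rank1Residual.AdditivePotMult.exists_shaAnOverC_eq_of_rat
    W K V (W.baseChange K) hE h2 hVd hV' hWfin hVfin hWR hq hq'
  refine ⟨_, hqK, ?_⟩
  -- (★) and non-vanishing
  have hstar := Summit.BirchSwinnertonDyer.Rank1Residual.AdditivePotMult.shaAnOverC_mul_eq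
    W K V (W.baseChange K) hE h2 hVd hV' hWfin hVfin hWR
  have hsW : W.shaOrder ≠ 0 := (W.shaOrder_pos hWfin).ne'
  have hsV : V.shaOrder ≠ 0 := (V.shaOrder_pos hVfin).ne'
  have hsK : (W.baseChange K).shaOrder ≠ 0 := ((W.baseChange K).shaOrder_pos hKfin).ne'
  have hq0 : q ≠ 0 := by
    intro h0
    apply Summit.BirchSwinnertonDyer.Rank1Residual.AdditivePotMult.shaAn_ne_zero W hE
    rw [hq, h0, Rat.cast_zero]
  have hq0' : q' ≠ 0 := by
    intro h0
    apply Summit.BirchSwinnertonDyer.Rank1Residual.AdditivePotMult.shaAn_ne_zero V hE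
    rw [hq', h0, Rat.cast_zero]
  -- (★) in `ℚ` for the rational value of `#Ш_an(W_K)`
  have hQ : (q * q' * (W.baseChange K).shaOrder / (W.shaOrder * V.shaOrder)) * W.shaOrder * V.shaOrder =
      q * q' * (W.baseChange K).shaOrder := by
    have hsWq : (W.shaOrder : ℚ) ≠ 0 := by exact_mod_cast hsW
    have hsVq : (V.shaOrder : ℚ) ≠ 0 := by exact_mod_cast hsV
    field_simp
  exact padicValRat_le_of_mul_eq 3 hq0 hq0' hsW hsV hsK hQ hle

end Summit.BirchSwinnertonDyer.BirchSwinnertonDyer.Theorems.RamifiedPairLowerBound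

end
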